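import Summits.ValiantsHypothesis.ValiantsHypothesis.Theorems.BarrierLeverChowHitsThinRowPartitionMinorsRDefectOne
import Summits.ValiantsHypothesis.ValiantsHypothesis.Theorems.BarrierLeverChowHitsThinRowPartitionMinorsRLabelsUsed

/-!
# Route BarrierLever — item `ChowHitsThinRowPartitionMinorsR` (stmt-ValiantsHypothesis-21850, budget
# `h·h`): NEAR-FULL thin rows of affine defect at most one are hit

Helper file (`--supports stmt-ValiantsHypothesis-21850`; cell valiant-natproofs, rung V4, 𝒟-side;
seat val-np-p5 gen 28).  Closes NO item; definition-free; imports this seat's `…RDefectOne`,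
`…RLabelsUsed`.

The two registered residual nodes of line `antipodal_gadget` (`stub_fullPairs`, `stub_missingPairs`)
concern NEAR-FULL rows, `h·h < #singles + h + 2·#pairs`, against columns of positive affine defect.
This file settles their sub-case «affine defect ≤ 1 on the used coordinates» unconditionally:

* `card_pairRows_add_choose_le` — if no pair row lies inside `A ⊆ Fin h`, then
  `#pairs + C(|A|, 2) ≤ C(h, 2)`;
* `exists_triangle_of_nearFull` — near-full rows with `#singles ≠ 1` contain a TRIANGLE of rows
  `{a}, {b}, {a,b}`;
* `card_singles_add_pairs_le`, `le_rows_of_nearFull` — near-full rows with `≥ 2` singletons have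
  `r ≥ h + 2` (`h ≥ 3`);
* `chowHitsHH_of_singleRow` — at most one singleton row and `r ≥ 2`: hit for ANY column family with a
  down-closed injective monomial basis (no defect hypothesis at all);
* `chowHitsHH_of_nearFull_defectLeOne` — near-full rows (`h ≥ 3`) and a down-closed injective basis
  `U` (`det [U i ⊆ w j] ≠ 0`) holding the singleton of every used coordinate except possibly one `c₀`
  ⇒ hit by `h·h` affine forms (via `chowHitsHH_of_defectOne`, p695712, and the two lemmas above).

WHAT THIS IS NOT: item 21850 is NOT proved — the residual is near-full rows × affine defect ≥ 2;
nothing on items 21882 / 19717, on crux stmt-ValiantsHypothesis-14610, or on `VP` versus `VNP`.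
-/

set_option linter.dupNamespace false

namespace Summit.ValiantsHypothesis.ValiantsHypothesis.Theorems.BarrierLever.ChowThinHH

open Finset MvPolynomial

variable {h r : ℕ}

/-- If no pair row of the injective row family `u` lies inside `A`, then the pair rows and the
2-subsets of `A` are disjoint families of 2-subsets of `Fin h`: `#pairs + C(|A|,2) ≤ C(h,2)`. -/
theorem card_pairRows_add_choose_le (u : Fin r → Finset (Fin h)) (hu : Function.Injective u)
    (A : Finset (Fin h)) (hno : ∀ i, (u i).card = 2 → ¬ u i ⊆ A) :
    (Finset.univ.filter fun i : Fin r => (u i).card = 2).card + A.card.choose 2 ≤ h.choose 2 := by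
  classical
  set P : Finset (Fin r) := Finset.univ.filter fun i : Fin r => (u i).card = 2 with hP
  have h1 : P.image u ∪ A.powersetCard 2 ⊆ (Finset.univ : Finset (Fin h)).powersetCard 2 := by
    intro S hS
    rcases Finset.mem_union.mp hS with hS | hS
    · obtain ⟨i, hi, rfl⟩ := Finset.mem_image.mp hS
      exact Finset.mem_powersetCard.mpr ⟨Finset.subset_univ _, (Finset.mem_filter.mp hi).2⟩
    · exact Finset.powersetCard_mono (Finset.subset_univ A) hS
  have h2 : Disjoint (P.image u) (A.powersetCard 2) := by
    rw [Finset.disjoint_left]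
    intro S hS hS'
    obtain ⟨i, hi, rfl⟩ := Finset.mem_image.mp hS
    exact hno i (Finset.mem_filter.mp hi).2 (Finset.mem_powersetCard.mp hS').1
  have h3 := Finset.card_le_card h1
  rw [Finset.card_union_of_disjoint h2, Finset.card_image_of_injOn (fun i _ j _ e => hu e),
    Finset.card_powersetCard, Finset.card_powersetCard, Finset.card_univ, Fintype.card_fin] at h3
  exact h3

/-- Singleton rows and pair rows are distinct rows: `#singles + #pairs ≤ r`. -/
theorem card_singles_add_pairs_le (u : Fin r → Finset (Fin h)) :
    (Finset.univ.filter fun i : Fin r => (u i).card = 1).card +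
      (Finset.univ.filter fun i : Fin r => (u i).card = 2).card ≤ r := by
  classical
  have hdisj : Disjoint (Finset.univ.filter fun i : Fin r => (u i).card = 1)
      (Finset.univ.filter fun i : Fin r => (u i).card = 2) :=
    Finset.disjoint_filter.mpr fun i _ h1 h2 => by omega
  have hle := Finset.card_le_univ ((Finset.univ.filter fun i : Fin r => (u i).card = 1) ∪
      (Finset.univ.filter fun i : Fin r => (u i).card = 2))
  rw [Fintype.card_fin, Finset.card_union_of_disjoint hdisj] at hle
  exact hle

/-- **Near-full rows contain a triangle.**  If `h·h < #singles + h + 2·#pairs` and `#singles ≠ 1`,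
there are two singleton rows `{a}`, `{b}` and the pair row `{a,b}`. -/
theorem exists_triangle_of_nearFull (u : Fin r → Finset (Fin h)) (hu : Function.Injective u)
    (hnear : h * h < (Finset.univ.filter fun i : Fin r => (u i).card = 1).card + h +
      2 * (Finset.univ.filter fun i : Fin r => (u i).card = 2).card)
    (hs : (Finset.univ.filter fun i : Fin r => (u i).card = 1).card ≠ 1) :
    ∃ s₁ s₂ p : Fin r, (u s₁).card = 1 ∧ (u s₂).card = 1 ∧ s₁ ≠ s₂ ∧ u p = u s₁ ∪ u s₂ := by
  classical
  set Sing : Finset (Fin r) := Finset.univ.filter fun i : Fin r => (u i).card = 1 with hSing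
  set A : Finset (Fin h) := Sing.biUnion u with hA
  have hAcard : A.card = Sing.card := by
    rw [hA, Finset.card_biUnion]
    · calc ∑ i ∈ Sing, (u i).card = ∑ i ∈ Sing, 1 :=
            Finset.sum_congr rfl fun i hi => (Finset.mem_filter.mp hi).2
        _ = Sing.card := by simp
    · intro i hi j hj hij
      obtain ⟨a, ha⟩ := Finset.card_eq_one.mp (Finset.mem_filter.mp hi).2
      obtain ⟨b, hb⟩ := Finset.card_eq_one.mp (Finset.mem_filter.mp hj).2
      show Disjoint (u i) (u j)
      rw [ha, hb, Finset.disjoint_singleton]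
      intro e
      exact hij (hu (by rw [ha, hb, e]))
  by_contra hno
  have hno' : ∀ i, (u i).card = 2 → ¬ u i ⊆ A := by
    intro i hi hsub
    obtain ⟨a, b, hab, he⟩ := Finset.card_eq_two.mp hi
    have ha : a ∈ A := hsub (by rw [he]; exact Finset.mem_insert_self _ _)
    have hb : b ∈ A := hsub (by rw [he]; exact Finset.mem_insert_of_mem (Finset.mem_singleton_self _))
    obtain ⟨s₁, hs₁, has₁⟩ := Finset.mem_biUnion.mp ha
    obtain ⟨s₂, hs₂, hbs₂⟩ := Finset.mem_biUnion.mp hb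
    have h1 := (Finset.mem_filter.mp hs₁).2
    have h2 := (Finset.mem_filter.mp hs₂).2
    have hu1 : u s₁ = {a} := by
      obtain ⟨a', ha'⟩ := Finset.card_eq_one.mp h1
      rw [ha'] at has₁ ⊢
      rw [Finset.mem_singleton.mp has₁]
    have hu2 : u s₂ = {b} := by
      obtain ⟨b', hb'⟩ := Finset.card_eq_one.mp h2
      rw [hb'] at hbs₂ ⊢
      rw [Finset.mem_singleton.mp hbs₂]
    refine hno ⟨s₁, s₂, i, h1, h2, fun e => hab ?_, by rw [he, hu1, hu2]; rfl⟩
    rw [e] at hu1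
    exact Finset.singleton_injective (hu1.symm.trans hu2)
  have hle := card_pairRows_add_choose_le u hu A hno'
  rw [hAcard] at hle
  have h3 := add_two_mul_choose_two h
  have h4 := add_two_mul_choose_two Sing.card
  have hp := card_pairRows_le u hu
  rcases Nat.lt_or_ge Sing.card 2 with hlt | hge
  · -- `#singles = 0`: near-fullness is impossible
    have h0 : Sing.card = 0 := by omega
    omega
  · have hsq : 2 * Sing.card ≤ Sing.card * Sing.card := Nat.mul_le_mul_right Sing.card hge
    omega

/-- Near-full rows with at least two singleton rows have at least `h + 2` rows (`h ≥ 3`). -/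
theorem le_rows_of_nearFull (u : Fin r → Finset (Fin h)) (hu : Function.Injective u) (h3 : 3 ≤ h)
    (hnear : h * h < (Finset.univ.filter fun i : Fin r => (u i).card = 1).card + h +
      2 * (Finset.univ.filter fun i : Fin r => (u i).card = 2).card)
    (hs : 2 ≤ (Finset.univ.filter fun i : Fin r => (u i).card = 1).card) : h + 2 ≤ r := by
  have hcard := card_singles_add_pairs_le u
  have hC := add_two_mul_choose_two h
  have hp := card_pairRows_le u hu
  have hh : 3 * h ≤ h * h := Nat.mul_le_mul_right h h3
  omega

/-- **At most one singleton row ⇒ hit**, for any column family admitting a down-closed injective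
monomial basis `U` (`det [U i ⊆ w j] ≠ 0`) and `r ≥ 2`: the singleton row (if any) takes a used
singleton label, the pair rows are gadgets; budget `|Cu| + 2·#pairs ≤ h + 2·C(h,2) = h·h`. -/
theorem chowHitsHH_of_singleRow (h r : ℕ) (u w : Fin r → Finset (Fin h))
    (hu : Function.Injective u) (hu2 : ∀ i, (u i).card ≤ 2)
    (hs : (Finset.univ.filter fun i : Fin r => (u i).card = 1).card ≤ 1) (hr : 2 ≤ r)
    (U : Fin r → Finset (Fin h)) (hUinj : Function.Injective U)
    (hUdown : ∀ i (S : Finset (Fin h)), S ⊆ U i → ∃ i', U i' = S)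
    (hZ : (Matrix.of fun i j : Fin r => if U i ⊆ w j then (1 : ℂ) else 0).det ≠ 0) :
    ∃ ℓ : Fin (h * h) → MvPolynomial (Fin (h + h)) ℂ, (∀ k, (ℓ k).totalDegree ≤ 1) ∧
      (Matrix.of fun i j : Fin r => MvPolynomial.coeff
        (∑ a ∈ u i, Finsupp.single (Fin.castAdd h a) 1 +
          ∑ c ∈ w j, Finsupp.single (Fin.natAdd h c) 1) (∏ k, ℓ k)).det ≠ 0 := by
  classical
  set Sing : Finset (Fin r) := Finset.univ.filter fun i : Fin r => (u i).card = 1 with hSing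
  set Cu : Finset (Fin h) := Finset.univ.biUnion w with hCu
  -- two labels: `∅` and a used singleton `{c}`
  have i₁ : Fin r := ⟨0, by omega⟩
  obtain ⟨j0, hj0⟩ : ∃ j, U j ≠ ∅ := by
    by_contra hno
    simp only [not_exists, not_not] at hno
    have e := hUinj ((hno ⟨0, by omega⟩).trans (hno ⟨1, by omega⟩).symm)
    simp [Fin.ext_iff] at e
  obtain ⟨c, hc⟩ := Finset.nonempty_iff_ne_empty.mpr hj0
  obtain ⟨j₁, hj₁⟩ := hUdown j0 {c} (Finset.singleton_subset_iff.mpr hc)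
  obtain ⟨je, hje⟩ := hUdown j0 ∅ (Finset.empty_subset _)
  have hjne : j₁ ≠ je := fun e => by
    have h1 : ({c} : Finset (Fin h)) = ∅ := hj₁.symm.trans (by rw [e, hje])
    exact Finset.singleton_ne_empty c h1
  have hcCu : c ∈ Cu := by
    by_contra hcn
    apply hZ
    refine Matrix.det_eq_zero_of_row_eq_zero j₁ fun j => ?_
    rw [Matrix.of_apply, if_neg]
    intro hsub
    apply hcn
    rw [hCu, Finset.mem_biUnion]
    exact ⟨j, Finset.mem_univ _, hsub (by rw [hj₁]; exact Finset.mem_singleton_self c)⟩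
  -- the assignment on the constrained rows (empty row ↦ `je`, singleton row ↦ `j₁`)
  set Zr : Finset (Fin r) := Finset.univ.filter fun i : Fin r => u i = ∅ with hZr
  set C : Finset (Fin r) := Zr ∪ Sing with hC
  set f : Fin r → Fin r := fun i => if u i = ∅ then je else j₁ with hf
  have hinj : Set.InjOn f C := by
    intro i hi i' hi' e
    have hcls : ∀ k, k ∈ (C : Set (Fin r)) → u k ≠ ∅ → k ∈ Sing := by
      intro k hk hk0
      simp only [hC, Finset.coe_union, Set.mem_union, Finset.mem_coe, hZr, Finset.mem_filter,
        Finset.mem_univ, true_and] at hk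
      rcases hk with hk | hk
      · exact absurd hk hk0
      · exact hk
    by_cases hi0 : u i = ∅ <;> by_cases hi0' : u i' = ∅
    · exact hu (hi0.trans hi0'.symm)
    · exfalso
      simp only [hf, if_pos hi0, if_neg hi0'] at e
      exact hjne e.symm
    · exfalso
      simp only [hf, if_neg hi0, if_pos hi0'] at e
      exact hjne e
    · exact Finset.card_le_one.mp hs i (hcls i hi hi0) i' (hcls i' hi' hi0')
  obtain ⟨ge, hge⟩ := Finset.exists_equiv_extend_of_card_eq (t := (Finset.univ : Finset (Fin r)))
    (by simp) (s := C) (f := f) (Finset.subset_univ _) hinj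
  set π : Fin r ≃ Fin r := ge.trans (Equiv.subtypeUnivEquiv Finset.mem_univ) with hπ
  have hπC : ∀ i ∈ C, π i = f i := by
    intro i hi
    rw [← hge i hi]
    rfl
  -- the relabelling
  set U' : Fin r → Finset (Fin h) := fun i => U (π i) with hU'
  have hU'inj : Function.Injective U' := hUinj.comp π.injective
  have hU'down : ∀ i (S : Finset (Fin h)), S ⊆ U' i → ∃ i', U' i' = S := by
    intro i S hS
    obtain ⟨j', hj'⟩ := hUdown (π i) S hS
    exact ⟨π.symm j', by simp only [hU', Equiv.apply_symm_apply, hj']⟩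
  have hU'empty : ∀ i, u i = ∅ → U' i = ∅ := by
    intro i hi
    have hiC : i ∈ C := Finset.mem_union_left _ (Finset.mem_filter.mpr ⟨Finset.mem_univ _, hi⟩)
    show U (π i) = ∅
    rw [hπC i hiC]
    simp only [hf, if_pos hi, hje]
  have hU'S : ∀ i ∈ Sing, U' i = {c} := by
    intro i hi
    have hi1 := (Finset.mem_filter.mp hi).2
    have hi0 : u i ≠ ∅ := fun e => by rw [e, Finset.card_empty] at hi1; exact absurd hi1 (by norm_num)
    show U (π i) = {c}
    rw [hπC i (Finset.mem_union_right _ hi)]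
    simp only [hf, if_neg hi0, hj₁]
  have hZ' : (Matrix.of fun i j : Fin r => if U' i ⊆ w j then (1 : ℂ) else 0).det ≠ 0 := by
    have e : (Matrix.of fun i j : Fin r => if U' i ⊆ w j then (1 : ℂ) else 0) =
        (Matrix.of fun i j : Fin r => if U i ⊆ w j then (1 : ℂ) else 0).submatrix π id := by
      ext i j
      rfl
    rw [e, Matrix.det_permute]
    refine mul_ne_zero ?_ hZ
    rcases Int.units_eq_one_or (Equiv.Perm.sign π) with h1 | h1 <;> simp [h1]
  refine chowHitsHH_of_labels_used h r u w hu hu2 U' hU'inj hU'down hU'empty hZ' ?_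
  -- budget
  have hsub : Sing.image U' ∪ Cu.image (fun c : Fin h => ({c} : Finset (Fin h))) ⊆
      Cu.image (fun c : Fin h => ({c} : Finset (Fin h))) := by
    intro S hS
    rcases Finset.mem_union.mp hS with h1 | h2
    · obtain ⟨i, hi, rfl⟩ := Finset.mem_image.mp h1
      rw [hU'S i hi]
      exact Finset.mem_image.mpr ⟨c, hcCu, rfl⟩
    · exact h2
  have hCu_h : Cu.card ≤ h := (Finset.card_le_univ _).trans (by rw [Fintype.card_fin])
  have hbound : (Sing.image U' ∪ Cu.image (fun c : Fin h => ({c} : Finset (Fin h)))).card ≤ h :=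
    (Finset.card_le_card hsub).trans (Finset.card_image_le.trans hCu_h)
  have hpairs := card_pairRows_le u hu
  have h3 := add_two_mul_choose_two h
  show (Sing.image U' ∪ Cu.image (fun c : Fin h => ({c} : Finset (Fin h)))).card +
      2 * (Finset.univ.filter fun i : Fin r => (u i).card = 2).card ≤ h * h
  omega

/-- **Near-full rows of affine defect at most one are hit** (`h ≥ 3`).  Rows: injective, of size
`≤ 2`, near-full (`h·h < #singles + h + 2·#pairs`).  Columns `w` (any): a down-closed injective
monomial basis `U` with `det [U i ⊆ w j] ≠ 0` holding the singleton `{c}` of every USED coordinate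
`c` except possibly `c₀`.  Then the layout is hit by `h·h` affine forms.  (Case `#singles = 1`: by
`chowHitsHH_of_singleRow`, no defect hypothesis; case `#singles ≥ 2`: a triangle exists and
`r ≥ h + 2`, so `chowHitsHH_of_defectOne` applies; `#singles = 0` contradicts near-fullness.) -/
theorem chowHitsHH_of_nearFull_defectLeOne (h r : ℕ) (u w : Fin r → Finset (Fin h))
    (hu : Function.Injective u) (hu2 : ∀ i, (u i).card ≤ 2) (h3 : 3 ≤ h)
    (hnear : h * h < (Finset.univ.filter fun i : Fin r => (u i).card = 1).card + h +
      2 * (Finset.univ.filter fun i : Fin r => (u i).card = 2).card)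
    (U : Fin r → Finset (Fin h)) (hUinj : Function.Injective U)
    (hUdown : ∀ i (S : Finset (Fin h)), S ⊆ U i → ∃ i', U i' = S)
    (hZ : (Matrix.of fun i j : Fin r => if U i ⊆ w j then (1 : ℂ) else 0).det ≠ 0)
    (c₀ : Fin h) (hUsing : ∀ c ∈ Finset.univ.biUnion w, c ≠ c₀ → ∃ i, U i = {c}) :
    ∃ ℓ : Fin (h * h) → MvPolynomial (Fin (h + h)) ℂ, (∀ k, (ℓ k).totalDegree ≤ 1) ∧
      (Matrix.of fun i j : Fin r => MvPolynomial.coeff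
        (∑ a ∈ u i, Finsupp.single (Fin.castAdd h a) 1 +
          ∑ c ∈ w j, Finsupp.single (Fin.natAdd h c) 1) (∏ k, ℓ k)).det ≠ 0 := by
  classical
  have hcard := card_singles_add_pairs_le u
  have hC := add_two_mul_choose_two h
  have hp := card_pairRows_le u hu
  rcases Nat.lt_or_ge (Finset.univ.filter fun i : Fin r => (u i).card = 1).card 2 with hlt | hge
  · have hs1 : (Finset.univ.filter fun i : Fin r => (u i).card = 1).card = 1 := by omega
    have hh : 3 * h ≤ h * h := Nat.mul_le_mul_right h h3
    exact chowHitsHH_of_singleRow h r u w hu hu2 hs1.le (by omega) U hUinj hUdown hZ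
  · obtain ⟨s₁, s₂, p, hs₁, hs₂, hs12, hp12⟩ := exists_triangle_of_nearFull u hu hnear (by omega)
    exact chowHitsHH_of_defectOne h r u w hu hu2 U hUinj hUdown hZ c₀ hUsing
      (le_rows_of_nearFull u hu h3 hnear hge) s₁ s₂ p hs₁ hs₂ hs12 hp12

end Summit.ValiantsHypothesis.ValiantsHypothesis.Theorems.BarrierLever.ChowThinHH
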